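/-
Copyright (c) 2026. All rights reserved.
Released under Apache 2.0 license as described in the file LICENSE.
Authors: abc-iut cell — author of record abc-iut-L3-d5 (G10 rung 2); filer-of-record abc-iut-w4-d064 (orphan rescue: module split / imports only).
-/
import Literature.AnabelianGeometry.SemiGraphs.UniversalCoveringOver
import Literature.AnabelianGeometry.SemiGraphs.TemperedResiduallyFinitePointed
import HarnessLib

/-!
# [SemiAnbd] Prop. 3.6 (iii): `π₁^temp(𝒢)` is residually finite — the named intermediate statements

Mochizuki, *Semi-graphs of anabelioids*, Publ. RIMS **42** (2006) [MochizukiSemiAnbd2006], §3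
Prop. 3.6 (iii) p. 38 and its proof p. 39 ("the `𝒢_{∞,i} → 𝒢` are tempered … Galois … cofinal among
all connected finite étale coverings … `Gal(𝒢_{∞,i}/𝒢)` is free-by-finite, hence residually
finite").  STATEMENTS ONLY (cell abc-iut, layer L3, G10 rung 2; author of record abc-iut-L3-d5, split
out of the assembly per L3-lead ruling υ2; filer abc-iut-w4-d064): the three named inputs of the
assembly `TemperedResiduallyFiniteAssembly.lean` —
* `GaloisApprox 𝒢`: every finite covering is split by a finite pointed covering with fibre-rigid and
  fibre-transitive endomorphisms (the levels of the Galois tower, p. 38 / [IUTchI] Rmk. 2.5.3 (i));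
* `GaloisApproxPt 𝒢`: the pointed/componentwise form for tempered coverings;
* `UnivCoverOverHomogeneous 𝒢`: `Aut(𝒢_{∞,A})` is transitive on the vertex fibres of `𝒢_{∞,A}`.
All three are PROVED in the tree (`galoisApprox_of_prop36`, `galoisApproxPt_of_prop36`,
`univCoverOverHomogeneous_holds` in `TemperedResiduallyFiniteHolds.lean`); they are intermediate
statements of the printed proof, not new facts.  Nothing here takes a side on [IUTchIII] Cor. 3.12.
-/

namespace Literature.AnabelianGeometry.SemiGraphs

namespace ProfiniteSemiGraph

open CategoryTheory

universe u

/-- The *Galois approximation property* of `𝒢` (output of the Galois tower of [SemiAnbd] p. 38 /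
[IUTchI] Rmk. 2.5.3 (i) (T2)): every finite covering is split by a finite covering `A` with a
point whose endomorphisms act *simply transitively* on each vertex fibre (transitive: `∃ σ`;
rigid: an endomorphism is determined by its value at any one point) — e.g. a connected Galois
object of the Galois category `B(𝒢)`. [cite: MochizukiSemiAnbd2006, Prop 3.6 p.38] -/
def GaloisApprox (𝒢 : ProfiniteSemiGraph.{u}) : Prop :=
  ∀ F : CovObj 𝒢, F.IsFinite → ∃ A : CovObj 𝒢, A.IsFinite ∧ Nonempty A.Point ∧
    (∀ (v : 𝒢.graph.Vertex) (x₀ : (A.SV v).obj.V) (σ σ' : A ⟶ A),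
      (σ.fV v).hom.hom x₀ = (σ'.fV v).hom.hom x₀ → σ = σ') ∧
    (∀ (v : 𝒢.graph.Vertex) (x x' : (A.SV v).obj.V), ∃ σ : A ⟶ A, (σ.fV v).hom.hom x = x') ∧
    A.Splits F

/-- Pointed form of the Galois approximation property: every connected component of every
tempered covering is split, pointwise, by a finite covering with a point and simply transitive
endomorphisms — the cofinality statement of [SemiAnbd] p. 38 ("cofinal among all connected finite
étale coverings") as delivered by the Galois tower. [cite: MochizukiSemiAnbd2006, Prop 3.6 p.38] -/
def GaloisApproxPt (𝒢 : ProfiniteSemiGraph.{u}) : Prop :=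
  ∀ (T : CovObj 𝒢), T.IsTempered → ∀ p : T.Point, ∃ A : CovObj 𝒢, A.IsFinite ∧ Nonempty A.Point ∧
    (∀ (v : 𝒢.graph.Vertex) (x₀ : (A.SV v).obj.V) (σ σ' : A ⟶ A),
      (σ.fV v).hom.hom x₀ = (σ'.fV v).hom.hom x₀ → σ = σ') ∧
    (∀ (v : 𝒢.graph.Vertex) (x x' : (A.SV v).obj.V), ∃ σ : A ⟶ A, (σ.fV v).hom.hom x = x') ∧
    ∀ q, T.SameComponent p q → A.SplitsAt T q

/-- The *homogeneity* input: for a covering `A` with fibre-transitive endomorphisms, `Aut(𝒢_{∞,A})`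
acts transitively on the vertex fibres of `𝒢_{∞,A}` ([SemiAnbd] p. 38, "Galois"; proved in
`UniversalCoveringOverHomogeneous`). [cite: MochizukiSemiAnbd2006, Prop 3.6 p.38] -/
def UnivCoverOverHomogeneous (𝒢 : ProfiniteSemiGraph.{u}) : Prop :=
  ∀ (h𝒢 : 𝒢.IsCountable) (A : CovObj 𝒢) (V₀ : A.OVertex),
    (∀ (v : 𝒢.graph.Vertex) (x x' : (A.SV v).obj.V), ∃ σ : A ⟶ A, (σ.fV v).hom.hom x = x') →
    ∀ {v : 𝒢.graph.Vertex} (t t' : A.FibV (Sum.inl V₀) v),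
      ∃ η : A.univCoverOver (Sum.inl V₀) h𝒢 ≅ A.univCoverOver (Sum.inl V₀) h𝒢,
        (η.hom.fV v).hom.hom t = t'

end ProfiniteSemiGraph

end Literature.AnabelianGeometry.SemiGraphs
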